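import Summits.BirchSwinnertonDyer.BirchSwinnertonDyer.Theorems.GenusKolyvaginAtTwoGenusDeepSupplyAtTwoNegDiscNarrowDepthZeroSilentOffTransposition
import Summits.BirchSwinnertonDyer.BirchSwinnertonDyer.Theorems.GenusKolyvaginAtTwoGenusDeepSupplyAtTwoNegDiscNarrowDepthZeroReductionBitOfK1
import Summits.BirchSwinnertonDyer.BirchSwinnertonDyer.Theorems.GenusKolyvaginAtTwoGenusDeepSupplyAtTwoNegDiscNarrowDepthZeroK1OfReductionBit
import Summits.BirchSwinnertonDyer.BirchSwinnertonDyer.Theorems.GenusKolyvaginAtTwoSupplyKernelsLossless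
import HarnessLib

/-!
# Route `GenusKolyvaginAtTwo`, crux `GenusDeepSupplyAtTwoNegDiscNarrow` (stmt-BirchSwinnertonDyer-23491): CLAIM B FOR COMPOSITE
# HEEGNER FIELDS, II — **K₁ ⟹ R₁ on the WHOLE `#Sel₂(E) = 1` cell**, hence **K₁ ⟺ R₁ as typed** and **R₁ ⟸ LEAF + PRINT**

Width seat `bsd-line-gk2-p4` g26 (cell `bsd-f1-sign2`), `--supports stmt-BirchSwinnertonDyer-23491` (helper; closes nothing).
THEOREMS ONLY (no definition, no named fact, no `sorry`); **BSD is NOT proved by any of this; no item is closed.**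

CONTEXT.  R₁ — the binder `hR` of `DepthZero.K1_of_reductionBit` (gk2-p5 g33, p762289) — quantifies over EVERY (H2)-admissible Heegner
field `K` of the `#Sel₂(E) = 1` cell of crux 23491 (odd `d_K ≠ −3`, Heegner, the two Theorem-B non-squares) and every narrow twin
(`r_an = 1`, `#Sel₂ = 2`, `ord₂ c(Wd) ≤ 1`), and asks for ONE prime `ℓ ∣ d_K` of good reduction and a lift `P₀ ↦ P(1) = y_K` with
`red_𝔓(e_*P₀) ≠ red_𝔓(e_*s)` for every `Aut(K/ℚ)`-fixed torsion `s ∈ E(K)`.  p762289 proved R₁ ⟹ K₁; g25's p764750 proved the converse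
only at the PRIME Heegner fields `d_K = −ℓ`.  With the silence extracted from the twin's Tamagawa clause
(`…DepthZeroSilentOffTransposition`, this seat) the converse holds at every admissible `K`:

* §1 `reductionBit_of_not_two_dvd_derivedPoint_of_silent` — g25's Gross-5.3 bookkeeping verbatim at a prime `ℓ ∣ d_K` with silence
  off `ℓ` (no primality of `d_K`): `y_K = P(1) ∉ 2E(K[1])` ⟹ the reduction bit at `ℓ`.
* §2 **`exists_reductionBit_of_not_two_dvd_derivedPoint`** — `W` globally minimal, `Δ_W < 0`, `r_an(W) = 0`, `ρ̄_{W,2}` onto, `C(W)` odd,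
  `#Sel₂(W) = 1`; `K` imaginary quadratic with odd `d_K`, Heegner, `d_K·Δ_W ∉ ℚ²`; `Wd ≅ W^{(d_K)}` elliptic with `ord₂ c(Wd) ≤ 1`; `d₁` with
  `P(1) ∉ 2E(K[1])` ⟹ **the conclusion of `hR` VERBATIM** (`∃ ℓ ∣ d_K, ℓ ∤ Δ_min, ∃ P₀ ↦ P(1), ∀ fixed torsion s, red(e_*P₀) ≠ red(e_*s)`).
* §3 **`reductionBit_of_K1 : K₁ → R₁`** (binders verbatim; `M₀` from `exists_exactTwoDivisibility_of_not_isOfFinAddOrder`, K₁ kills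
  `M₀ ≥ 1`, §2 at `M₀ = 0`) and **`K1_iff_reductionBit : K₁ ↔ R₁`** — itemising the reduction bit R₁ in place of K₁ is LOSSLESS on the
  whole cell, not only on prime fields; §4 **`reductionBit_of_nonCMAtTwo`**: R₁ ⟸ `NonCMAtTwo` + the four PRINT items (gk2-p5 g34's
  `Lossless.K1_of_nonCMAtTwo` ∘ §3) — a refutation of R₁ AS TYPED refutes the leaf or a print typing.

References: [GrossLMS1991] §5 Prop. 5.3, §4 (4.1); [McCallumLMS1991] §5 Lemma 5.1; [MazurRubin2010] Lemma 2.2 (i), Prop. 3.3,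
Cor. 3.4 (i); [Kramer1981] §2 Prop. 3; [SilvermanAEC2009] X.5 Cor. 5.4, VIII §1–§2, VII.3.1; [SerreLocalFields1979] I §7.
-/

set_option autoImplicit false
set_option linter.dupNamespace false -- `Summit.<P>.<Sub>` repeats `BirchSwinnertonDyer` (D-0017)

noncomputable section

open scoped Classical NumberField Pointwise

namespace Summit.BirchSwinnertonDyer.BirchSwinnertonDyer.Theorems.GenusSupplyNarrow.DepthZero

open IsDedekindDomain Field NumberField WeierstrassCurve Literature.NumberTheory.EllipticCurves
  Literature.NumberTheory.EllipticCurves.ModularForms Literature.NumberTheory.GaloisRepresentations Rat.HeightOneSpectrum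
  Summit.BirchSwinnertonDyer.BirchSwinnertonDyer.Theses.GenusKolyvaginAtTwo
  Summit.BirchSwinnertonDyer.BirchSwinnertonDyer.Theorems.GenusSupplyNarrow
open Summit.BirchSwinnertonDyer.BirchSwinnertonDyer.Theorems.GenusKolyTwistingPrime (primesEquiv_eq)
open Summit.BirchSwinnertonDyer.BirchSwinnertonDyer.Theorems.GenusExact.PlusDescent (not_dvd_minimalDiscriminantInt_of_dvd_discr_of_heegner)
open Summit.BirchSwinnertonDyer.BirchSwinnertonDyer.Theorems.GenusKoly (exists_exactTwoDivisibility_of_not_isOfFinAddOrder)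

variable {K : Type} [Field K] [NumberField K]

/-- In an additive commutative group, an element of odd order killed by `2` is `0`. [folklore] -/
private theorem eq_zero_of_two_smul_eq_zero_of_odd_addOrderOf' {A : Type*} [AddCommGroup A] {x : A}
    (h2 : (2 : ℤ) • x = 0) (hodd : Odd (addOrderOf x)) : x = 0 := by
  have hdvd : addOrderOf x ∣ 2 := by
    apply addOrderOf_dvd_of_nsmul_eq_zero
    rw [← natCast_zsmul]
    exact_mod_cast h2
  rcases (Nat.dvd_prime Nat.prime_two).mp hdvd with h1 | h2'
  · exact AddMonoid.addOrderOf_eq_one_iff.mp h1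
  · exfalso
    rw [h2'] at hodd
    exact (Nat.not_even_iff_odd.mpr hodd) even_two

/-! ## §1 K₁ ⟹ the reduction bit at a prime `ℓ ∣ d_K` with silence off `ℓ` -/

/-- **K₁ ⟹ R₁ AT A PRIME `ℓ ∣ d_K` WITH SILENCE OFF `ℓ`.** `W/ℚ` globally minimal elliptic with `Δ_W < 0`, `r_an(W) = 0` (so `w = +1`),
`ρ̄_{W,2}` onto, `#Sel₂(W) = 1`; `K` imaginary quadratic with odd `d_K`, Heegner for `N_W`, `d_K·Δ_W ∉ ℚ²` (so `E(K[1])[2] = 0`);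
`ℓ ∣ d_K` an odd prime, `v₀ ∋ ℓ`, every OTHER prime of `d_K` silent for `W` and `W^{(d_K)}`; `d₁` a conductor-`1` Kolyvagin–Heegner
datum whose point `y_K = P(1)` is NOT halvable in `E(K[1])` (K₁, `M₀ = 0`). THEN `ℓ ∤ Δ_min(W)` and for some `P₀ ∈ E(K)` over `P(1)`,
**`red_𝔓(e_*P₀) ≠ red_𝔓(e_*s)` for every `Aut(K/ℚ)`-fixed torsion `s ∈ E(K)`**.  Proof = g25's p764750 verbatim (Gross 5.3: `t₀ = τP₀ + P₀`
odd-order torsion, `Y = P₀ − s₀` anti-invariant, `∉ 2E(K)`, `red(e_*Y) ≠ Õ` by Claim B, `2·red(e_*Y) = Õ` by inertia, odd-order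
bookkeeping), with Claim B in its silence form. [cite: GrossLMS1991, §5 Prop. 5.3, §4 (4.1)] [cite: MazurRubin2010, Prop. 3.3, Cor. 3.4 (i)]
[cite: SilvermanAEC2009, X.5 Cor. 5.4, VII.3.1] -/
theorem reductionBit_of_not_two_dvd_derivedPoint_of_silent (W : WeierstrassCurve ℚ) [W.IsElliptic] [W.IsGloballyMinimal]
    [NeZero (W.conductorNorm ℤ)] (hΔneg : W.Δ < 0) (hr0 : W.analyticRank = 0) (hρ : W.HasSurjectiveModNGaloisRep 2)
    (h1 : Nat.card (W.selmerGroup 2) = 1)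
    (hK : IsImaginaryQuadratic K) (hodd : Odd (NumberField.discr K)) (hH : SatisfiesHeegnerHypothesis (W.conductorNorm ℤ) K)
    (hsq : ¬ IsSquare ((NumberField.discr K : ℚ) * W.Δ))
    {ℓ : ℕ} [Fact ℓ.Prime] (hℓd : (ℓ : ℤ) ∣ NumberField.discr K)
    {v₀ : HeightOneSpectrum (𝓞 ℚ)} (hv₀ : (ℓ : 𝓞 ℚ) ∈ v₀.asIdeal)
    (hsil : ∀ v : HeightOneSpectrum (𝓞 ℚ), v ≠ v₀ → (((primesEquiv v : Nat.Primes) : ℕ) : ℤ) ∣ NumberField.discr K →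
      Nat.card (nsmulAddMonoidHom 2 : (W.baseChange (v.adicCompletion ℚ)).toAffine.Point →+ _).ker = 1 ∧
      Nat.card (nsmulAddMonoidHom 2 :
        ((W.quadraticTwist (NumberField.discr K : ℚ)).baseChange (v.adicCompletion ℚ)).toAffine.Point →+ _).ker = 1)
    (Dt : ModularParametrizationData W (W.conductorNorm ℤ)) (β : ℤ) (ι : K →+* ℂ) (d₁ : KolyvaginHeegnerData Dt β ι 1)
    (hK1 : ¬ ∃ Q : (W.baseChange (ringClassField K ι 1)).toAffine.Point, (2 : ℤ) • Q = d₁.derivedPoint) :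
    ∃ (hΔ : ¬ (ℓ : ℤ) ∣ minimalDiscriminantInt W) (P₀ : (W.baseChange K).toAffine.Point),
      Affine.Point.map (W' := W) (algebraMap K (ringClassField K ι 1)).toRatAlgHom P₀ = d₁.derivedPoint ∧
      ∀ s : (W.baseChange K).toAffine.Point, IsOfFinAddOrder s → (∀ σ : K ≃ₐ[ℚ] K, σ • s = s) →
        geomReduction hΔ (Affine.Point.map (W' := W) (absEmbedding ℚ K) P₀ : W.geomPoints) ≠
          geomReduction hΔ (Affine.Point.map (W' := W) (absEmbedding ℚ K) s : W.geomPoints) := by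
  have hℓ : ℓ.Prime := Fact.out
  have hℓ2 : ℓ ≠ 2 := by
    rintro rfl
    obtain ⟨r, hr⟩ := hodd
    omega
  have h2 : Module.finrank ℚ K = 2 := hK.1
  haveI : Algebra.IsQuadraticExtension ℚ K := ⟨h2⟩
  haveI : IsGalois ℚ K := inferInstance
  have hcard : Nat.card (K ≃ₐ[ℚ] K) = 2 := by rw [IsGalois.card_aut_eq_finrank, h2]
  have hΔ : ¬ (ℓ : ℤ) ∣ minimalDiscriminantInt W := not_dvd_minimalDiscriminantInt_of_dvd_discr_of_heegner W K h2 hH hℓ hℓ2 hℓd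
  refine ⟨hΔ, ?_⟩
  -- `E(K[1])[2] = 0`, hence `E(K)[2] = 0`
  have htors : ∀ T : (W.baseChange (ringClassField K ι 1)).toAffine.Point, (2 : ℤ) • T = 0 → T = 0 := by
    intro T hT
    have h := GenusExact.torsionBy_two_ringClassField_eq_bot W hK ι one_ne_zero hρ hsq
    have hT' : T ∈ AddSubgroup.torsionBy (W.baseChange (ringClassField K ι 1)).toAffine.Point ((2 : ℕ) : ℤ) :=
      (Submodule.mem_torsionBy_iff _ T).mpr (by exact_mod_cast hT)
    rw [h] at hT'
    exact (AddSubgroup.mem_bot).mp hT'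
  set i : (W.baseChange K).toAffine.Point →+ (W.baseChange (ringClassField K ι 1)).toAffine.Point :=
    Affine.Point.map (W' := W) (algebraMap K (ringClassField K ι 1)).toRatAlgHom with hi
  have hiinj : Function.Injective i := Affine.Point.map_injective (W' := W) _
  have h2K : ∀ T : (W.baseChange K).toAffine.Point, (2 : ℤ) • T = 0 → T = 0 := by
    intro T hT
    apply hiinj
    rw [map_zero]
    exact htors _ (by rw [← map_zsmul, hT, map_zero])
  -- `P₀ ∈ E(K)` over `P(1)`: a Heegner point
  obtain ⟨P₀, hP₀H, hP₀⟩ := heegnerSystem_exists_isHeegnerPoint_map_eq_derivedPoint_one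
    (heegnerPointOfConductor_one_galoisConj_holds (W.conductorNorm ℤ) W K) hK hH d₁
  refine ⟨P₀, hP₀, fun s hsfin _hsfix hred ↦ ?_⟩
  -- `w(E) = +1`; the non-trivial automorphism `τ`; Gross 5.3: `t₀ = τP₀ + P₀` is torsion
  have hw1 : W.rootNumber = 1 := W.rootNumber_eq_one_of_even_analyticRank (by rw [hr0]; exact Even.zero)
  obtain ⟨v, hv⟩ : ∃ v : HeightOneSpectrum (𝓞 ℚ), (primesEquiv v : ℕ) = ℓ :=
    ⟨primesEquiv.symm ⟨ℓ, Fact.out⟩, by rw [Equiv.apply_symm_apply]⟩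
  obtain ⟨𝔓, hmem, h𝔓⟩ := exists_ideal_placeOver (p := ℓ) hv
  obtain ⟨γ, hγI, τ, hτ1, hγ⟩ := exists_mem_inertia_smul_absEmbedding_eq h2 hℓd hv h𝔓
  have hττ : τ * τ = 1 := by
    rcases Literature.NumberTheory.QuadraticFields.eq_one_or_eq_of_card_eq_two hcard hτ1 (τ * τ) with h | h
    · exact h
    · exact absurd (mul_left_cancel (a := τ) (h.trans (mul_one τ).symm)) hτ1
  obtain ⟨e, he⟩ : ∃ e : (W.baseChange K).toAffine.Point →+ W.geomPoints,
      e = Affine.Point.map (W' := W) (absEmbedding ℚ K) := ⟨_, rfl⟩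
  have heinj : Function.Injective e := by rw [he]; exact Affine.Point.map_injective (W' := W) _
  have hequiv : ∀ R : (W.baseChange K).toAffine.Point, γ • e R = e (τ • R) := fun R ↦ by
    rw [he]; exact smul_eq_map_absEmbedding_smul W hγ R _ rfl
  have hσ : (τ : K →ₐ[ℚ] K) ≠ AlgHom.id ℚ K := fun h ↦ hτ1 (AlgEquiv.ext fun x ↦ DFunLike.congr_fun h x)
  set t₀ : (W.baseChange K).toAffine.Point := τ • P₀ + P₀ with ht₀
  have ht₀fin : IsOfFinAddOrder t₀ := by
    have h := heegnerPoint_conj_add_rootNumber_smul.apply heegnerPoint_conj_add_rootNumber_smul_holds hK hH hP₀H hσ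
    rwa [hw1, one_smul, ← WeierstrassCurve.smul_def W K τ P₀] at h
  have hτt₀ : τ • t₀ = t₀ := by
    rw [ht₀, smul_add, ← mul_smul, hττ, one_smul, add_comm]
  -- `t₀` has odd order `m`; `s₀ = ((m+1)/2)·t₀` with `2s₀ = t₀`
  have hodd₀ : Odd (addOrderOf t₀) :=
    odd_addOrderOf_of_two_torsionFree ht₀fin fun k hk ↦ h2K _ hk
  obtain ⟨m', hm'⟩ := hodd₀
  set c : ℤ := (m' : ℤ) + 1 with hc
  set s₀ : (W.baseChange K).toAffine.Point := c • t₀ with hs₀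
  have hs₀fin : IsOfFinAddOrder s₀ := ht₀fin.zsmul
  have h2s₀ : (2 : ℤ) • s₀ = t₀ := by
    have hcm : (2 : ℤ) * c = (addOrderOf t₀ : ℤ) + 1 := by rw [hc, hm']; push_cast; ring
    rw [hs₀, smul_smul, hcm, add_zsmul, one_zsmul, natCast_zsmul, addOrderOf_nsmul_eq_zero, zero_add]
  have hsm : τ • (c • t₀) = c • (τ • t₀) :=
    map_zsmul (DistribSMul.toAddMonoidHom ((W.baseChange K).toAffine.Point) τ) c t₀
  have hτs₀ : τ • s₀ = s₀ := by rw [hs₀, hsm, hτt₀]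
  -- the anti-invariant point `Y = P₀ − s₀`
  set Y : (W.baseChange K).toAffine.Point := P₀ - s₀ with hY
  have hanti : τ • Y = -Y := by
    have hτP : τ • P₀ = -P₀ + t₀ := by rw [ht₀]; abel
    rw [hY, smul_sub, hτs₀, hτP, ← h2s₀, two_zsmul]
    abel
  -- `Y ∉ 2E(K)` (else `y_K ∈ 2E(K[1])`)
  have hY2 : ¬ ∃ Q : (W.baseChange K).toAffine.Point, (2 : ℤ) • Q = Y := by
    rintro ⟨Q, hQ⟩
    apply hK1
    refine ⟨i (Q + c • s₀), ?_⟩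
    rw [← map_zsmul, ← hP₀]
    change i ((2 : ℤ) • (Q + c • s₀)) = i P₀
    congr 1
    have : (2 : ℤ) • (c • s₀) = s₀ := by rw [smul_comm, h2s₀]
    rw [zsmul_add, hQ, this, hY, sub_add_cancel]
  -- Claim B on the curve (silence form): `red(e_*Y) ≠ Õ`
  have hredY := geomReduction_map_absEmbedding_ne_zero_of_anti_of_not_two_dvd_of_silent W hΔneg hK hodd hH hℓ2 hv₀ hsil h1 hτ1
    hanti hY2 hΔ
  -- `2 · red(e_*Y) = red(e_*P₀) − red(γ · e_*P₀) = Õ`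
  have h2Y : (2 : ℤ) • geomReduction hΔ (e Y) = 0 := by
    have hYY : (2 : ℤ) • Y = P₀ - τ • P₀ := by
      rw [hY, zsmul_sub, h2s₀, ht₀]
      abel
    rw [← map_zsmul, ← map_zsmul, hYY, map_sub, map_sub, ← hequiv,
      geomReduction_smul_of_mem_inertia hΔ hmem hγI, sub_self]
  -- `red(e_*Y) = red(e_*(s − s₀))` has odd order: contradiction
  have hssfin : IsOfFinAddOrder (s - s₀) := by
    rw [← AddCommGroup.mem_torsion]
    exact (AddCommGroup.torsion _).sub_mem ((AddCommGroup.mem_torsion _).mpr hsfin)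
      ((AddCommGroup.mem_torsion _).mpr hs₀fin)
  have hsodd : Odd (addOrderOf (s - s₀)) := odd_addOrderOf_of_two_torsionFree hssfin fun k hk ↦ h2K _ hk
  have hredeq : geomReduction hΔ (e Y) = geomReduction hΔ (e (s - s₀)) := by
    have h' : geomReduction hΔ (e P₀) = geomReduction hΔ (e s) := by rw [he]; exact hred
    rw [hY, map_sub, map_sub, h', ← map_sub, ← map_sub]
  have hodd' : Odd (addOrderOf (geomReduction hΔ (e Y))) := by
    rw [hredeq]
    exact hsodd.of_dvd_nat ((addOrderOf_map_dvd (geomReduction hΔ) _).trans (addOrderOf_map_dvd e _))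
  apply hredY
  rw [← he]
  exact eq_zero_of_two_smul_eq_zero_of_odd_addOrderOf' h2Y hodd'

/-! ## §2 K₁ ⟹ R₁ at EVERY admissible Heegner field: the silence comes from the twin's Tamagawa clause -/

/-- **CLAIM B FOR COMPOSITE HEEGNER FIELDS — K₁ ⟹ R₁ in the LITERAL shape of the binder `hR`** of `DepthZero.K1_of_reductionBit`:
`W/ℚ` globally minimal elliptic with `Δ_W < 0`, `r_an(W) = 0`, `ρ̄_{W,2}` onto, `C(W)` odd, `#Sel₂(W) = 1`; `K` imaginary quadratic with
odd `d_K` (ANY number of prime factors), Heegner for `N_W`, `d_K·Δ_W ∉ ℚ²`; `Wd ≅ W^{(d_K)}` an elliptic model with **`ord₂ c(Wd) ≤ 1`**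
(the narrow twin's Tamagawa clause); `d₁` a conductor-`1` datum with `y_K = P(1) ∉ 2E(K[1])` (K₁).  THEN
**`∃ ℓ ∣ d_K` prime, `ℓ ∤ Δ_min(W)`, `∃ P₀ ↦ P(1)`, `∀` Aut-fixed torsion `s ∈ E(K)`: `red_𝔓(e_*P₀) ≠ red_𝔓(e_*s)`**.  The prime `ℓ` is
the one prime of `d_K` left unsilenced by `ord₂ c(Wd) ≤ 1` (`exists_prime_dvd_discr_forall_ne_twoTorsion_padic_eq_zero`); the
silence is transported to the pair `(W, W^{(d_K)})` (`silent_off_of_forall_ne_twoTorsion_padic_eq_zero`) and §1 applies.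
[cite: GrossLMS1991, §5 Prop. 5.3] [cite: MazurRubin2010, Lemma 2.2 (i), Prop. 3.3, Cor. 3.4 (i)] [cite: Kramer1981, §2 Prop. 3] -/
theorem exists_reductionBit_of_not_two_dvd_derivedPoint (W : WeierstrassCurve ℚ) [W.IsElliptic] [W.IsGloballyMinimal]
    [NeZero (W.conductorNorm ℤ)] (hΔneg : W.Δ < 0) (hr0 : W.analyticRank = 0) (hρ : W.HasSurjectiveModNGaloisRep 2)
    (hT : Odd W.tamagawaProduct) (h1 : Nat.card (W.selmerGroup 2) = 1)
    (hK : IsImaginaryQuadratic K) (hodd : Odd (NumberField.discr K)) (hH : SatisfiesHeegnerHypothesis (W.conductorNorm ℤ) K)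
    (hsq : ¬ IsSquare ((NumberField.discr K : ℚ) * W.Δ))
    {Wd : WeierstrassCurve ℚ} [Wd.IsElliptic]
    (hWd : ∃ C : WeierstrassCurve.VariableChange ℚ, C • W.quadraticTwist (NumberField.discr K : ℚ) = Wd)
    (hDEF : padicValNat 2 Wd.tamagawaProduct ≤ 1)
    (Dt : ModularParametrizationData W (W.conductorNorm ℤ)) (β : ℤ) (ι : K →+* ℂ) (d₁ : KolyvaginHeegnerData Dt β ι 1)
    (hK1 : ¬ ∃ Q : (W.baseChange (ringClassField K ι 1)).toAffine.Point, (2 : ℤ) • Q = d₁.derivedPoint) :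
    ∃ (ℓ : ℕ) (_ : Fact ℓ.Prime) (_ : (ℓ : ℤ) ∣ NumberField.discr K) (hΔ : ¬ (ℓ : ℤ) ∣ minimalDiscriminantInt W)
      (P₀ : (W.baseChange K).toAffine.Point),
      Affine.Point.map (W' := W) (algebraMap K (ringClassField K ι 1)).toRatAlgHom P₀ = d₁.derivedPoint ∧
      ∀ s : (W.baseChange K).toAffine.Point, IsOfFinAddOrder s → (∀ σ : K ≃ₐ[ℚ] K, σ • s = s) →
        geomReduction hΔ (Affine.Point.map (W' := W) (absEmbedding ℚ K) P₀ : W.geomPoints) ≠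
          geomReduction hΔ (Affine.Point.map (W' := W) (absEmbedding ℚ K) s : W.geomPoints) := by
  obtain ⟨Cd, hCd⟩ := hWd
  have hd0 : (NumberField.discr K : ℚ) ≠ 0 := by exact_mod_cast (IsImaginaryQuadratic.discr_neg hK).ne
  -- the one unsilenced prime `ℓ ∣ d_K`
  obtain ⟨ℓ, hℓ, hℓd, hsilQ⟩ :=
    exists_prime_dvd_discr_forall_ne_twoTorsion_padic_eq_zero W hK hodd hH hT Cd hCd hDEF
  haveI : Fact ℓ.Prime := ⟨hℓ⟩
  -- the place `v₀` of `ℚ` over `ℓ`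
  obtain ⟨v₀, hv₀'⟩ : ∃ v : HeightOneSpectrum (𝓞 ℚ), ((primesEquiv v : Nat.Primes) : ℕ) = ℓ :=
    ⟨primesEquiv.symm ⟨ℓ, hℓ⟩, by rw [Equiv.apply_symm_apply]⟩
  have hv₀ : (ℓ : 𝓞 ℚ) ∈ v₀.asIdeal := by
    rw [← hv₀']
    exact Rat.HeightOneSpectrum.natCast_natGenerator_mem v₀
  -- silence off `v₀` for the pair `(W, W^{(d_K)})`
  haveI : (W.quadraticTwist (NumberField.discr K : ℚ)).IsElliptic := W.isElliptic_quadraticTwist hd0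
  have hC1 : (1 : VariableChange ℚ) • W.quadraticTwist (NumberField.discr K : ℚ) = W.quadraticTwist (NumberField.discr K : ℚ) :=
    one_smul _ _
  have hsil := silent_off_of_forall_ne_twoTorsion_padic_eq_zero W hd0 hℓ hsilQ hv₀ hC1
  obtain ⟨hΔ, P₀, hP₀, hred⟩ :=
    reductionBit_of_not_two_dvd_derivedPoint_of_silent W hΔneg hr0 hρ h1 hK hodd hH hsq hℓd hv₀ hsil Dt β ι d₁ hK1
  exact ⟨ℓ, ⟨hℓ⟩, hℓd, hΔ, P₀, hP₀, hred⟩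

/-! ## §3 K₁ ⟺ R₁ as typed -/

/-- **K₁ ⟹ R₁ (binders VERBATIM: `hK1` of `GenusSupplyNarrow.stubC_negDisc_of_selmerSplit` ⟹ `hR` of `DepthZero.K1_of_reductionBit`).**
Given a frame of R₁, McCallum's exponent `M₀` of `y_K = P(1)` exists (`exists_exactTwoDivisibility_of_not_isOfFinAddOrder`); K₁ forbids
`1 ≤ M₀`, so `M₀ = 0`, i.e. `P(1) ∉ 2E(K[1])`, and §2 yields the bit (`ρ̄_{E,2}` onto from the habitat at `n = 1`; `d_K·Δ ∉ ℚ²` is the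
crux's first Theorem-B clause since `Δ < 0`).  No primality of `d_K` is needed: the converse of p762289 on the WHOLE cell.
[cite: GrossLMS1991, §5 Prop. 5.3, §4 (4.1)] [cite: McCallumLMS1991, §5 Lemma 5.1] [cite: MazurRubin2010, Prop. 3.3, Cor. 3.4 (i)] -/
theorem reductionBit_of_K1
    (hK1 : ∀ (W : WeierstrassCurve ℚ) [W.IsElliptic] [W.IsGloballyMinimal] [NeZero (W.conductorNorm ℤ)],
      ¬ W.HasCM → W.analyticRank = 0 → (∀ n : ℕ, 0 < n → W.HasSurjectiveModNGaloisRep ((2 : ℤ) ^ n)) →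
      Odd W.tamagawaProduct → W.Δ < 0 → Nat.card (W.selmerGroup 2) = 1 →
      ∀ (K : Type) [Field K] [NumberField K],
      IsImaginaryQuadratic K → Odd (NumberField.discr K) → NumberField.discr K ≠ -3 →
      SatisfiesHeegnerHypothesis (W.conductorNorm ℤ) K →
      ¬ IsSquare ((NumberField.discr K : ℚ) * -|W.Δ|) → ¬ IsSquare ((NumberField.discr K : ℚ) * (-(2 * |W.Δ|))) →
      ∀ (Dt : ModularParametrizationData W (W.conductorNorm ℤ)),
      (∀ z ∈ Dt.L.lattice, ∃ w ∈ periodLattice Dt.f, z = (Dt.c : ℂ) * w) → Odd Dt.c →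
      ∀ (β : ℤ) (ι : K →+* ℂ) (d₁ : KolyvaginHeegnerData Dt β ι 1), ¬ IsOfFinAddOrder d₁.derivedPoint →
      ∀ (M₀ : ℕ), (∃ Q : (W.baseChange (ringClassField K ι 1)).toAffine.Point, ((2 ^ M₀ : ℕ) : ℤ) • Q = d₁.derivedPoint) →
      (¬ ∃ Q : (W.baseChange (ringClassField K ι 1)).toAffine.Point, ((2 ^ (M₀ + 1) : ℕ) : ℤ) • Q = d₁.derivedPoint) →
      1 ≤ M₀ →
      ∀ (Wd : WeierstrassCurve ℚ) [Wd.IsElliptic] [Wd.IsGloballyMinimal],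
      (∃ C : WeierstrassCurve.VariableChange ℚ, C • W.quadraticTwist (NumberField.discr K : ℚ) = Wd) →
      Wd.analyticRank = 1 → Nat.card (Wd.selmerGroup 2) = 2 → padicValNat 2 Wd.tamagawaProduct ≤ 1 →
      False) :
    ∀ (W : WeierstrassCurve ℚ) [W.IsElliptic] [W.IsGloballyMinimal] [NeZero (W.conductorNorm ℤ)],
      ¬ W.HasCM → W.analyticRank = 0 → (∀ n : ℕ, 0 < n → W.HasSurjectiveModNGaloisRep ((2 : ℤ) ^ n)) →
      Odd W.tamagawaProduct → W.Δ < 0 → Nat.card (W.selmerGroup 2) = 1 →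
      ∀ (K : Type) [Field K] [NumberField K],
      IsImaginaryQuadratic K → Odd (NumberField.discr K) → NumberField.discr K ≠ -3 →
      SatisfiesHeegnerHypothesis (W.conductorNorm ℤ) K →
      ¬ IsSquare ((NumberField.discr K : ℚ) * -|W.Δ|) → ¬ IsSquare ((NumberField.discr K : ℚ) * (-(2 * |W.Δ|))) →
      ∀ (Dt : ModularParametrizationData W (W.conductorNorm ℤ)),
      (∀ z ∈ Dt.L.lattice, ∃ w ∈ periodLattice Dt.f, z = (Dt.c : ℂ) * w) → Odd Dt.c →
      ∀ (β : ℤ) (ι : K →+* ℂ) (d₁ : KolyvaginHeegnerData Dt β ι 1), ¬ IsOfFinAddOrder d₁.derivedPoint →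
      ∀ (Wd : WeierstrassCurve ℚ) [Wd.IsElliptic] [Wd.IsGloballyMinimal],
      (∃ C : WeierstrassCurve.VariableChange ℚ, C • W.quadraticTwist (NumberField.discr K : ℚ) = Wd) →
      Wd.analyticRank = 1 → Nat.card (Wd.selmerGroup 2) = 2 → padicValNat 2 Wd.tamagawaProduct ≤ 1 →
      ∃ (ℓ : ℕ) (_ : Fact ℓ.Prime) (_ : (ℓ : ℤ) ∣ NumberField.discr K) (hΔ : ¬ (ℓ : ℤ) ∣ minimalDiscriminantInt W)
        (P₀ : (W.baseChange K).toAffine.Point),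
        Affine.Point.map (W' := W) (algebraMap K (ringClassField K ι 1)).toRatAlgHom P₀ = d₁.derivedPoint ∧
        ∀ s : (W.baseChange K).toAffine.Point, IsOfFinAddOrder s → (∀ σ : K ≃ₐ[ℚ] K, σ • s = s) →
          geomReduction hΔ (Affine.Point.map (W' := W) (absEmbedding ℚ K) P₀ : W.geomPoints) ≠
            geomReduction hΔ (Affine.Point.map (W' := W) (absEmbedding ℚ K) s : W.geomPoints) := by
  intro W _ _ _ hcm hr0 hρ hT hneg h1 K _ _ hIQ hodd h3 hHe hsq1 hsq2 Dt hoptDt hc β ι d₁ hy Wd _ _ hWd hrd hSel hDEF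
  have hρ2 : W.HasSurjectiveModNGaloisRep 2 := by simpa using hρ 1 one_pos
  have hsq : ¬ IsSquare ((NumberField.discr K : ℚ) * W.Δ) := by
    rwa [show -|W.Δ| = W.Δ by rw [abs_of_neg hneg, neg_neg]] at hsq1
  -- McCallum's exponent of `y_K`; K₁ forces `M₀ = 0`
  obtain ⟨M₀, hdiv, hndiv⟩ := exists_exactTwoDivisibility_of_not_isOfFinAddOrder W hIQ Dt β ι d₁ hy
  have hM0 : M₀ = 0 := by
    by_contra hM
    exact hK1 W hcm hr0 hρ hT hneg h1 K hIQ hodd h3 hHe hsq1 hsq2 Dt hoptDt hc β ι d₁ hy M₀ hdiv hndiv (by omega) Wd hWd hrd hSel hDEF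
  subst hM0
  have hK1pt : ¬ ∃ Q : (W.baseChange (ringClassField K ι 1)).toAffine.Point, (2 : ℤ) • Q = d₁.derivedPoint := by
    simpa using hndiv
  exact exists_reductionBit_of_not_two_dvd_derivedPoint W hneg hr0 hρ2 hT h1 hIQ hodd hHe hsq hWd hDEF Dt β ι d₁ hK1pt

/-- **K₁ ⟺ R₁ AS TYPED** (`reductionBit_of_K1` + gk2-p5 g33's `K1_of_reductionBit`): on the `#Sel₂(E) = 1` cell of crux 23491 the kernel
«the C‴-frame with `1 ≤ M₀` is contradictory» and the reduction bit «`y_K ≢` Aut-fixed torsion mod some `𝔓 ∣ ℓ ∣ d_K`» are EQUIVALENT at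
every (H2)-admissible Heegner field — itemising R₁ in place of K₁ is lossless on the WHOLE cell. [cite: GrossLMS1991, §5 Prop. 5.3, §4 (4.1)]
[cite: McCallumLMS1991, §5 Lemma 5.1] [cite: MazurRubin2010, Prop. 3.3, Cor. 3.4 (i)] -/
theorem K1_iff_reductionBit :
    (∀ (W : WeierstrassCurve ℚ) [W.IsElliptic] [W.IsGloballyMinimal] [NeZero (W.conductorNorm ℤ)],
      ¬ W.HasCM → W.analyticRank = 0 → (∀ n : ℕ, 0 < n → W.HasSurjectiveModNGaloisRep ((2 : ℤ) ^ n)) →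
      Odd W.tamagawaProduct → W.Δ < 0 → Nat.card (W.selmerGroup 2) = 1 →
      ∀ (K : Type) [Field K] [NumberField K],
      IsImaginaryQuadratic K → Odd (NumberField.discr K) → NumberField.discr K ≠ -3 →
      SatisfiesHeegnerHypothesis (W.conductorNorm ℤ) K →
      ¬ IsSquare ((NumberField.discr K : ℚ) * -|W.Δ|) → ¬ IsSquare ((NumberField.discr K : ℚ) * (-(2 * |W.Δ|))) →
      ∀ (Dt : ModularParametrizationData W (W.conductorNorm ℤ)),
      (∀ z ∈ Dt.L.lattice, ∃ w ∈ periodLattice Dt.f, z = (Dt.c : ℂ) * w) → Odd Dt.c →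
      ∀ (β : ℤ) (ι : K →+* ℂ) (d₁ : KolyvaginHeegnerData Dt β ι 1), ¬ IsOfFinAddOrder d₁.derivedPoint →
      ∀ (M₀ : ℕ), (∃ Q : (W.baseChange (ringClassField K ι 1)).toAffine.Point, ((2 ^ M₀ : ℕ) : ℤ) • Q = d₁.derivedPoint) →
      (¬ ∃ Q : (W.baseChange (ringClassField K ι 1)).toAffine.Point, ((2 ^ (M₀ + 1) : ℕ) : ℤ) • Q = d₁.derivedPoint) →
      1 ≤ M₀ →
      ∀ (Wd : WeierstrassCurve ℚ) [Wd.IsElliptic] [Wd.IsGloballyMinimal],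
      (∃ C : WeierstrassCurve.VariableChange ℚ, C • W.quadraticTwist (NumberField.discr K : ℚ) = Wd) →
      Wd.analyticRank = 1 → Nat.card (Wd.selmerGroup 2) = 2 → padicValNat 2 Wd.tamagawaProduct ≤ 1 →
      False) ↔
    (∀ (W : WeierstrassCurve ℚ) [W.IsElliptic] [W.IsGloballyMinimal] [NeZero (W.conductorNorm ℤ)],
      ¬ W.HasCM → W.analyticRank = 0 → (∀ n : ℕ, 0 < n → W.HasSurjectiveModNGaloisRep ((2 : ℤ) ^ n)) →
      Odd W.tamagawaProduct → W.Δ < 0 → Nat.card (W.selmerGroup 2) = 1 →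
      ∀ (K : Type) [Field K] [NumberField K],
      IsImaginaryQuadratic K → Odd (NumberField.discr K) → NumberField.discr K ≠ -3 →
      SatisfiesHeegnerHypothesis (W.conductorNorm ℤ) K →
      ¬ IsSquare ((NumberField.discr K : ℚ) * -|W.Δ|) → ¬ IsSquare ((NumberField.discr K : ℚ) * (-(2 * |W.Δ|))) →
      ∀ (Dt : ModularParametrizationData W (W.conductorNorm ℤ)),
      (∀ z ∈ Dt.L.lattice, ∃ w ∈ periodLattice Dt.f, z = (Dt.c : ℂ) * w) → Odd Dt.c →
      ∀ (β : ℤ) (ι : K →+* ℂ) (d₁ : KolyvaginHeegnerData Dt β ι 1), ¬ IsOfFinAddOrder d₁.derivedPoint →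
      ∀ (Wd : WeierstrassCurve ℚ) [Wd.IsElliptic] [Wd.IsGloballyMinimal],
      (∃ C : WeierstrassCurve.VariableChange ℚ, C • W.quadraticTwist (NumberField.discr K : ℚ) = Wd) →
      Wd.analyticRank = 1 → Nat.card (Wd.selmerGroup 2) = 2 → padicValNat 2 Wd.tamagawaProduct ≤ 1 →
      ∃ (ℓ : ℕ) (_ : Fact ℓ.Prime) (_ : (ℓ : ℤ) ∣ NumberField.discr K) (hΔ : ¬ (ℓ : ℤ) ∣ minimalDiscriminantInt W)
        (P₀ : (W.baseChange K).toAffine.Point),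
        Affine.Point.map (W' := W) (algebraMap K (ringClassField K ι 1)).toRatAlgHom P₀ = d₁.derivedPoint ∧
        ∀ s : (W.baseChange K).toAffine.Point, IsOfFinAddOrder s → (∀ σ : K ≃ₐ[ℚ] K, σ • s = s) →
          geomReduction hΔ (Affine.Point.map (W' := W) (absEmbedding ℚ K) P₀ : W.geomPoints) ≠
            geomReduction hΔ (Affine.Point.map (W' := W) (absEmbedding ℚ K) s : W.geomPoints)) :=
  ⟨fun hK1 ↦ reductionBit_of_K1 hK1, fun hR ↦ K1_of_reductionBit hR⟩

/-! ## §4 R₁ follows from the leaf modulo PRINT -/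

/-- **R₁ ⟸ LEAF + PRINT.**  The reduction bit R₁ (binder `hR` of `DepthZero.K1_of_reductionBit`, ∀ admissible `K`) follows from the rung-K4
leaf `Rank1Residual.NonCMAtTwo` and the four PRINT items `GrossZagierAllLevels`, `EntireLFunctionRat`, `MultPublishedInputsAtTwo`,
`MilneAnyModel` (gk2-p5 g34's `Lossless.K1_of_nonCMAtTwo` ∘ §3): a refutation of R₁ as typed refutes the leaf or a print typing — the
reduction-bit ledger p762861's `hR1` carries no over-claim on ANY Heegner field.  CONDITIONAL on the leaf; BSD is NOT proved by this.
[cite: GrossZagier1986, V.§2 (2.2)] [cite: GrossLMS1991, §5 Prop. 5.3] [cite: McCallumLMS1991, §5 Lemma 5.1] [cite: Kramer1981, Thm. 1] -/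
theorem reductionBit_of_nonCMAtTwo
    (hleaf : Summit.BirchSwinnertonDyer.BirchSwinnertonDyer.Rank1Residual.NonCMAtTwo) (hGZ : GrossZagierAllLevels)
    (hL : EntireLFunctionRat) (hGZK : MultPublishedInputsAtTwo) (hMi : MilneAnyModel) :
    ∀ (W : WeierstrassCurve ℚ) [W.IsElliptic] [W.IsGloballyMinimal] [NeZero (W.conductorNorm ℤ)],
      ¬ W.HasCM → W.analyticRank = 0 → (∀ n : ℕ, 0 < n → W.HasSurjectiveModNGaloisRep ((2 : ℤ) ^ n)) →
      Odd W.tamagawaProduct → W.Δ < 0 → Nat.card (W.selmerGroup 2) = 1 →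
      ∀ (K : Type) [Field K] [NumberField K],
      IsImaginaryQuadratic K → Odd (NumberField.discr K) → NumberField.discr K ≠ -3 →
      SatisfiesHeegnerHypothesis (W.conductorNorm ℤ) K →
      ¬ IsSquare ((NumberField.discr K : ℚ) * -|W.Δ|) → ¬ IsSquare ((NumberField.discr K : ℚ) * (-(2 * |W.Δ|))) →
      ∀ (Dt : ModularParametrizationData W (W.conductorNorm ℤ)),
      (∀ z ∈ Dt.L.lattice, ∃ w ∈ periodLattice Dt.f, z = (Dt.c : ℂ) * w) → Odd Dt.c →
      ∀ (β : ℤ) (ι : K →+* ℂ) (d₁ : KolyvaginHeegnerData Dt β ι 1), ¬ IsOfFinAddOrder d₁.derivedPoint →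
      ∀ (Wd : WeierstrassCurve ℚ) [Wd.IsElliptic] [Wd.IsGloballyMinimal],
      (∃ C : WeierstrassCurve.VariableChange ℚ, C • W.quadraticTwist (NumberField.discr K : ℚ) = Wd) →
      Wd.analyticRank = 1 → Nat.card (Wd.selmerGroup 2) = 2 → padicValNat 2 Wd.tamagawaProduct ≤ 1 →
      ∃ (ℓ : ℕ) (_ : Fact ℓ.Prime) (_ : (ℓ : ℤ) ∣ NumberField.discr K) (hΔ : ¬ (ℓ : ℤ) ∣ minimalDiscriminantInt W)
        (P₀ : (W.baseChange K).toAffine.Point),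
        Affine.Point.map (W' := W) (algebraMap K (ringClassField K ι 1)).toRatAlgHom P₀ = d₁.derivedPoint ∧
        ∀ s : (W.baseChange K).toAffine.Point, IsOfFinAddOrder s → (∀ σ : K ≃ₐ[ℚ] K, σ • s = s) →
          geomReduction hΔ (Affine.Point.map (W' := W) (absEmbedding ℚ K) P₀ : W.geomPoints) ≠
            geomReduction hΔ (Affine.Point.map (W' := W) (absEmbedding ℚ K) s : W.geomPoints) :=
  reductionBit_of_K1 (Lossless.K1_of_nonCMAtTwo hleaf hGZ hL hGZK hMi)

end Summit.BirchSwinnertonDyer.BirchSwinnertonDyer.Theorems.GenusSupplyNarrow.DepthZero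

end
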